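import Summits.BirchSwinnertonDyer.BirchSwinnertonDyer.Theorems.GenusKolyvaginAtTwoGenusPrimitiveSupplyAtTwoTwistSelmerTransferDownRat
import Summits.BirchSwinnertonDyer.BirchSwinnertonDyer.Theorems.GenusKolyvaginAtTwoEquivariantKolyvaginExactAtTwoLocalDualityPerfect
import Summits.BirchSwinnertonDyer.Rank1Residual.X11b.KummerRelaxationIndexExact
import Literature.NumberTheory.EllipticCurves.WeilPairingProofs
import HarnessLib

/-!
# Route `CMKolyvaginAtInertTwo`, crux `CMKolyvaginExactAtInertTwo` (stmt-BirchSwinnertonDyer-24277):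
# THE SECOND BIT ITSELF, modulo Poitou–Tate — at an odd finite place `v` of `ℚ` with `#E(ℚ_v)[2] = 2`,
# a class strict at `u` and Selmer elsewhere is KILLED at `v` by any class that is Selmer off `{v, u}`
# and NOT Selmer at `v`

Seat `bsd-line-cmk2-p1` g8 (cell `bsd-print-cf2`); helper (`--supports stmt-BirchSwinnertonDyer-24277`);
seventh file of the over-`ℚ` bit. THEOREMS ONLY; no item is closed; BSD is not proved by this.

This is the `ℚ`-side heart of the binder (dual) of `…RationalDescentAtTwoPrimeDiscr` (p630585): for
`ξ, κ ∈ H¹(ℚ, E[2])` with `ξ` Selmer at every place `≠ u` and STRICT at `u` (`loc_u ξ = 0`), `κ`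
Selmer at every place `∉ {v, u}` and NOT Selmer at `v` (`v ≠ u` finite, `v ∤ 2`, `#E(ℚ_v)[2] = 2` — a
Kolyvagin prime at `2` on `Δ_E < 0`), Poitou–Tate gives `∑_w inv_w(loc κ ∪ₑ loc ξ) = 0`; every term
off `{v, u}` vanishes (the Kummer conditions are isotropic, tree `invWeilPairing_eq_zero_of_mem`), the
term at `u` vanishes (`loc_u ξ = 0`), so `inv_v(loc_v κ ∪ₑ loc_v ξ) = 0`; the local Kummer condition
`𝓛_v` has ORDER `#E(ℚ_v)[2]·#(ℤ_v/2) = 2` (tree `natCard_kummerLocalConditionAt_adicCompletion`) and is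
ITS OWN ANNIHILATOR (Tate local duality off `2`, X11b's `forall_mem_kummer_invWeilPairing_eq_zero_iff`
with gk2-p3's unconditional Euler-characteristic count `hEuler_of_not_mem`); if `loc_v ξ ≠ 0` then
`𝓛_v = {0, loc_v ξ}` is annihilated by `loc_v κ`, forcing `loc_v κ ∈ 𝓛_v` — contradiction. Hence
**`loc_v ξ = 0`**: the bit that is invisible over `K_λ` (`cor ∘ res = 2`).

* `torsionLocalKer_of_reciprocity_rat` — the statement above, modulo the PRINT named fact
  `poitouTate_selmerStructure_duality_real ℚ` (Milne ADT I.4.10 with real places; it supplies the family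
  `inv` with `IsPerfect` — injectivity of `inv_v` — and `SumLocalTermEqZero`); the Weil pairing is the
  tree's theorem `exists_weilPairing_holds`.
What then remains of (dual) is plumbing: `ξ ∈ torsionLocalKer_ℚ(v) ⟹ res ξ ∈ torsionLocalKer_K(λ)`
(restriction of a locally trivial class is locally trivial; the `H¹(K, E)`-level analogue is the tree's
`ShaRestriction.localRestrictionKer_le_of_tower` / `mem_localRestrictionKer_iff_resBaseChange_mem`), and
the local descent of `κ` (= (desc-fin) for the Kolyvagin class).

References: [MilneADT2006] I Cor. 2.3, Cor. 3.4, Thm. 4.10, Lemma 6.15; [PoonenRains2012] Prop. 4.10;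
[McCallumLMS1991] §2 Prop. 2.2, §5 Lemma 5.3; [GrossLMS1991] §8 (Prop. 8.2 at a place of `ℚ`).
-/

-- single-conjunct summit: `Summit.BirchSwinnertonDyer.BirchSwinnertonDyer.…` repeats the name by design
set_option linter.dupNamespace false
set_option autoImplicit false

noncomputable section

open scoped Classical ContRepresentation
open WeierstrassCurve NumberField IsDedekindDomain Field Function
open Literature.NumberTheory.GaloisRepresentations Literature.NumberTheory.EllipticCurves
open Literature.NumberTheory.GaloisRepresentations.DiscreteGaloisModule (SelmerStructure)
open Literature.NumberTheory.GaloisCohomology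
open Summit.BirchSwinnertonDyer.Rank1Residual.X11b
open Summit.BirchSwinnertonDyer.Rank1Residual.X11b.Relaxation (invWeilPairing invWeilPairing_apply)

namespace Summit.BirchSwinnertonDyer.BirchSwinnertonDyer.Theorems.KolyvaginRatDescentTwo

-- Cup products need `LocallyCompactSpace Γ_{K_v}`: as in all the tree's local-duality files
-- (`LocalTateDualityOrderForE`, X11b `KummerPoitouTateExact`, gk2-p3 `…LocalDualityPerfect`), the
-- compactness of absolute Galois groups is a LOCAL instance only (nothing is overridden).
attribute [local instance] absoluteGaloisGroup_compactSpace

variable (W : WeierstrassCurve ℚ) [W.IsElliptic]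

/-- **THE SECOND BIT, modulo Poitou–Tate.** `E/ℚ` elliptic; `u ≠ v` finite places of `ℚ` with `v ∤ 2`
and `#E(ℚ_v)[2] = 2`; `ξ ∈ H¹(ℚ, E[2])` Selmer at every finite place `≠ u` and at `∞`, strict at `u`;
`κ ∈ H¹(ℚ, E[2])` Selmer at every finite place `∉ {v, u}` and at `∞`, NOT Selmer at `v`. GIVEN the print
facts `poitouTate_selmerStructure_duality_real ℚ` (Milne I.4.10) and `localEulerPoincareCharacteristic ℚ_v`
(Tate, Milne I.2.8): `ξ` is strict at `v` (`loc_v ξ = 0`).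
[cite: MilneADT2006, Ch. I, Cor. 3.4, Thm. 4.10 and Lemma 6.15] [cite: PoonenRains2012, Prop. 4.10]
[cite: McCallumLMS1991, §2 Prop. 2.2 and §5 Lemma 5.3] -/
theorem torsionLocalKer_of_reciprocity_rat (hPT : poitouTate_selmerStructure_duality_real ℚ)
    {u v : HeightOneSpectrum (𝓞 ℚ)} (hEP : localEulerPoincareCharacteristic (v.adicCompletion ℚ))
    (hvu : v ≠ u) (h2v : ((2 : ℕ) : 𝓞 ℚ) ∉ v.asIdeal)
    (ht : Nat.card (nsmulAddMonoidHom 2 :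
      (W.baseChange (v.adicCompletion ℚ)).toAffine.Point →+ _).ker = 2)
    {ξ κ : galH1Torsion W ((2 : ℕ) : ℤ)}
    (hξ : (∀ v' : HeightOneSpectrum (𝓞 ℚ), v' ≠ u →
        ξ ∈ selmerLocalKer W (v'.adicCompletion ℚ) ((2 : ℕ) : ℤ)) ∧
      ∀ w : InfinitePlace ℚ, ξ ∈ selmerLocalKer W w.Completion ((2 : ℕ) : ℤ))
    (hξu : ξ ∈ W.torsionLocalKer (u.adicCompletion ℚ) ((2 : ℕ) : ℤ))
    (hκ : (∀ v' : HeightOneSpectrum (𝓞 ℚ), v' ≠ v → v' ≠ u →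
        κ ∈ selmerLocalKer W (v'.adicCompletion ℚ) ((2 : ℕ) : ℤ)) ∧
      ∀ w : InfinitePlace ℚ, κ ∈ selmerLocalKer W w.Completion ((2 : ℕ) : ℤ))
    (hκv : κ ∉ selmerLocalKer W (v.adicCompletion ℚ) ((2 : ℕ) : ℤ)) :
    ξ ∈ W.torsionLocalKer (v.adicCompletion ℚ) ((2 : ℕ) : ℤ) := by
  haveI : Fact (Nat.Prime 2) := ⟨Nat.prime_two⟩
    -- the Weil pairing on `E[2]` and the Poitou–Tate family of invariant maps
  obtain ⟨e, hμ, hadd₁, hadd₂, halt, hnondeg, hgal⟩ :=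
    exists_weilPairing_holds W 2 le_rfl two_ne_zero
  obtain ⟨inv, hperf, hvan, -, -, -⟩ := hPT 2
  -- `loc_w x ∈ 𝓚_w ↔ x ∈ selmerLocalKer (completion at w)`
  have key : ∀ (w : Place ℚ) (x : galH1Torsion W ((2 : ℕ) : ℤ)),
      galoisCohomology.localization (W.torsionGaloisModule ((2 : ℕ) : ℤ)) w 1 x ∈
          W.kummerSelmerStructure ((2 : ℕ) : ℤ) w ↔
        x ∈ selmerLocalKer W (Place.Completion w) ((2 : ℕ) : ℤ) := fun w x ↦
    SetLike.ext_iff.mp (W.comap_localization_kummerSelmerStructure ((2 : ℕ) : ℤ) w) x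
  -- `κ, ξ ∈ kummerOutside {v, u}`
  have hS : ∀ x : galH1Torsion W ((2 : ℕ) : ℤ),
      ((∀ v' : HeightOneSpectrum (𝓞 ℚ), v' ≠ v → v' ≠ u →
          x ∈ selmerLocalKer W (v'.adicCompletion ℚ) ((2 : ℕ) : ℤ)) ∧
        ∀ w : InfinitePlace ℚ, x ∈ selmerLocalKer W w.Completion ((2 : ℕ) : ℤ)) →
      x ∈ kummerOutside W 2 {(Sum.inr v : Place ℚ), Sum.inr u} := by
    intro x hx
    refine (mem_kummerOutside_iff W 2 _ x).mpr fun w hw ↦ ?_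
    rw [Finset.mem_insert, Finset.mem_singleton, not_or] at hw
    rcases w with w | w
    · exact (key (Sum.inl w) x).mpr (hx.2 w)
    · exact (key (Sum.inr w) x).mpr
        (hx.1 w (fun h ↦ hw.1 (by rw [h])) (fun h ↦ hw.2 (by rw [h])))
  have hκO := hS κ hκ
  have hξO := hS ξ ⟨fun v' _ hv'u ↦ hξ.1 v' hv'u, hξ.2⟩
  -- Poitou–Tate over `ℚ` at `S = {v, u}`; the term at `u` vanishes since `loc_u ξ = 0`
  have hsum := KummerPT.sum_invWeilPairing_localization_eq_zero_of_mem_kummerOutside W 2 e hμ hadd₁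
    hadd₂ hgal halt inv hvan {(Sum.inr v : Place ℚ), Sum.inr u} hκO hξO
  have hne : (Sum.inr v : Place ℚ) ≠ Sum.inr u := fun h ↦ hvu (Sum.inr_injective h)
  rw [Finset.sum_pair hne] at hsum
  have hξu0 :
      galoisCohomology.localization (W.torsionGaloisModule ((2 : ℕ) : ℤ)) (Sum.inr u) 1 ξ = 0 :=
    (GenusKolyTwistLocal.mem_torsionLocalKer_iff_localization_eq_zero_rat W u ξ).mp hξu
  have hu0 : invWeilPairing W 2 e hμ hadd₁ hadd₂ hgal inv (Sum.inr u)
      (galoisCohomology.localization (W.torsionGaloisModule ((2 : ℕ) : ℤ)) (Sum.inr u) 1 κ)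
      (galoisCohomology.localization (W.torsionGaloisModule ((2 : ℕ) : ℤ)) (Sum.inr u) 1 ξ) = 0 := by
    rw [hξu0, map_zero]
  rw [hu0, add_zero] at hsum
  -- hsum : inv_v(loc_v κ ∪ₑ loc_v ξ) = 0.  Suppose `loc_v ξ ≠ 0`.
  by_contra hξv
  have hξv0 :
      galoisCohomology.localization (W.torsionGaloisModule ((2 : ℕ) : ℤ)) (Sum.inr v) 1 ξ ≠ 0 := fun h ↦
    hξv ((GenusKolyTwistLocal.mem_torsionLocalKer_iff_localization_eq_zero_rat W v ξ).mpr h)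
  have hξvL : galoisCohomology.localization (W.torsionGaloisModule ((2 : ℕ) : ℤ)) (Sum.inr v) 1 ξ ∈
      W.kummerSelmerStructure ((2 : ℕ) : ℤ) (Sum.inr v) :=
    (key (Sum.inr v) ξ).mpr (hξ.1 v hvu)
  -- `#𝓛_v = #E(ℚ_v)[2] · #(ℤ_v/2) = 2`
  have hcardL : Nat.card (W.kummerSelmerStructure ((2 : ℕ) : ℤ) (Sum.inr v)) = 2 := by
    rw [kummerSelmerStructure_apply]
    change Nat.card (W.kummerLocalConditionAt ((2 : ℕ) : ℤ) (v.adicCompletion ℚ)) = 2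
    rw [natCard_kummerLocalConditionAt_adicCompletion W v two_ne_zero, ht,
      GenusKolyTwistLocal.natCard_quotient_span_natCast_eq_one_of_not_mem v h2v, mul_one]
  -- so `𝓛_v = {0, loc_v ξ}`: every `y ∈ 𝓛_v` is annihilated by `loc_v κ`
  have hall : ∀ y ∈ W.kummerSelmerStructure ((2 : ℕ) : ℤ) (Sum.inr v),
      invWeilPairing W 2 e hμ hadd₁ hadd₂ hgal inv (Sum.inr v)
        (galoisCohomology.localization (W.torsionGaloisModule ((2 : ℕ) : ℤ)) (Sum.inr v) 1 κ) y = 0 := by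
    intro y hy
    by_cases hy0 : y = 0
    · rw [hy0, map_zero]
    · -- `y = loc_v ξ`: both are the unique non-zero element of the order-`2` group `𝓛_v`
      obtain ⟨z, -, hz⟩ := (Nat.card_eq_two_iff' (⟨0, AddSubgroup.zero_mem _⟩ :
        W.kummerSelmerStructure ((2 : ℕ) : ℤ) (Sum.inr v))).mp hcardL
      have h1 : (⟨y, hy⟩ : W.kummerSelmerStructure ((2 : ℕ) : ℤ) (Sum.inr v)) = z :=
        hz _ (fun h ↦ hy0 (congrArg Subtype.val h))
      have h2 : (⟨galoisCohomology.localization (W.torsionGaloisModule ((2 : ℕ) : ℤ)) (Sum.inr v) 1 ξ,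
          hξvL⟩ : W.kummerSelmerStructure ((2 : ℕ) : ℤ) (Sum.inr v)) = z :=
        hz _ (fun h ↦ hξv0 (congrArg Subtype.val h))
      have hyξ :
          y = galoisCohomology.localization (W.torsionGaloisModule ((2 : ℕ) : ℤ)) (Sum.inr v) 1 ξ := by
        have := congrArg Subtype.val (h1.trans h2.symm)
        exact this
      rw [hyξ]
      exact hsum
  -- perfectness of `𝓛_v` (Tate local duality off `2`): `loc_v κ ∈ 𝓛_v` — contradiction
  have hinj : Injective (inv (Sum.inr v)) := (hperf v).1.injective
  have hEuler := natCard_galoisCohomology_one_torsion_adicCompletion_eq_sq W v 2 Nat.prime_two.isPrimePow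
    hEP
  have hall' : ∀ y ∈ W.kummerSelmerStructure ((2 : ℕ) : ℤ) (Sum.inr v),
      (weilContPairingLocal W 2 e hμ hadd₁ hadd₂ hgal (Sum.inr v)).cupProduct
        (galoisCohomology.localization (W.torsionGaloisModule ((2 : ℕ) : ℤ)) (Sum.inr v) 1 κ) y = 0 := by
    intro y hy
    have h := hall y hy
    rw [invWeilPairing_apply] at h
    exact (map_eq_zero_iff (inv (Sum.inr v)) hinj).mp h
  have hκL : galoisCohomology.localization (W.torsionGaloisModule ((2 : ℕ) : ℤ)) (Sum.inr v) 1 κ ∈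
      W.kummerSelmerStructure ((2 : ℕ) : ℤ) (Sum.inr v) :=
    (forall_mem_kummerSelmerStructure_weilCupProduct_eq_zero_iff_inr_of_eulerChar W v 2 e hμ hadd₁ hadd₂
      hgal halt hnondeg hEuler _).mp hall'
  exact hκv ((key (Sum.inr v) κ).mp hκL)

end Summit.BirchSwinnertonDyer.BirchSwinnertonDyer.Theorems.KolyvaginRatDescentTwo

end
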